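import Summits.Ventures.CertifiedManyBodySolver.Downfold.EmeryOrbitalWeightNodeBox
import Summits.Ventures.CertifiedManyBodySolver.Downfold.EmeryScaleBoxNCCONH085Pts1
import Summits.Ventures.CertifiedManyBodySolver.Downfold.EmeryScaleBoxNCCONH085PtsL
import HarnessLib

/-!
# THE NODAL FERMI-SURFACE Cu-d WEIGHT WINDOW OVER THE NCCO (K) #24 SOURCE BOX (electron-doped, ν = 23/40) — both ends of the two-corner rule (kernel
# `EmeryOrbitalWeightNodeBox`, INFL-3to1-B §B.89 (c)) — the row the §B.90 (h)/(m) census could not print (no g36 FL/TP brackets existed for NCCO) (INFL-3to1-B §B.91 (f))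

Venture CertifiedManyBodySolver, cell `pub/hubbard-downfold` (stage S1), seat hubbard-downfold-mod-4 (technique B, g40); namespace
`Summit.Ventures.CertifiedManyBodySolver.Downfold.Emery`. Everything PROVED (0 sorry; NO new decide: the K = 384 brackets of the §B.91 scale device are re-read — the
telescoped ceiling-edge point 0 = (Δ₁, a₂, b₂, c) `edgePtU_NCCONH085_0_br` gives E_h = 2.7021, the floor corner (Δ₂, a₁, b₁, c) `scalePt_NCCONH085_LN_br` gives E_l = 1.3085;
closed-form corner arithmetic `norm_num [dWeightNodeCF]`). WHAT THIS IS NOT: a statement about the material — the typed box is SCREENING-GRADE; `U = 0` one-body kinematics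
of the σ model; the node is the LEAST Cu-like Fermi point (`EmeryOrbitalWeightMonotone`).

| box | material | filling | E_l | E_h | **w_node window** |
|---|---|---|---|---|---|
| `NCCO` (emeryBoxNCCOK26Src (EmeryBoxesKSlicesB)) | Nd₂₋ₓCeₓCuO₄ x = 0.15 (electron-doped; (K) #24 source box) | nH085 (ν = 23/40) | 1.3085 | 2.7021 | **[0.3872, 0.6821]** |

Sources: three-band model [HybertsenSchluterChristensen1989, Eq. (1)]; nodal decoupling [AndersenEtAl1995, §6, Eq. (24)]; [folklore] algebra.
-/

noncomputable section

namespace Summit.Ventures.CertifiedManyBodySolver.Downfold.Emery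

open Real Set

/-- **`emeryBoxNCCOK26Src (EmeryBoxesKSlicesB)` (Nd₂₋ₓCeₓCuO₄ x = 0.15 (electron-doped; (K) #24 source box)), n_H = 0.85 (ν = 23/40): for EVERY member the Cu-d weight of the NODAL Fermi-surface state lies in `[0.3872, 0.6821]`** — two-corner rule
`dWeightNodeCF(Δ₁, a₁, b₂ − c₁; E_h) ≤ w_node ≤ dWeightNodeCF(Δ₂, a₂, b₁ − c₂; E_l)` (§B.89 (c)); brackets `scalePt_NCCONH085_LN_br` / `edgePtU_NCCONH085_0_br`. [folklore] -/
theorem nCCOBox_dWeightNode_nH085 {Δ a b c : ℝ} (hΔ : Δ ∈ Icc (1 : ℝ) ((41 : ℝ) / 20)) (ha : a ∈ Icc ((9 : ℝ) / 10) ((129 : ℝ) / 100)) (hb : b ∈ Icc ((13 : ℝ) / 25) ((18 : ℝ) / 25)) (hc : c ∈ Icc ((1 : ℝ) / 50) ((1 : ℝ) / 50)) :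
    dWeightNode Δ a b c (fermiEnergyOf Δ a b c ((23 : ℝ) / 40)) ∈ Icc ((242 : ℝ) / 625) ((6821 : ℝ) / 10000) := by
  have hF := (fermiEnergyOf_of_pointBracketCheck scalePt_NCCONH085_LN_br (by norm_num) (by norm_num) (by norm_num) (ν := (23/40 : ℝ))
    (by push_cast; exact ⟨le_rfl, le_rfl⟩)).2
  have hT := (fermiEnergyOf_of_pointBracketCheck edgePtU_NCCONH085_0_br (by norm_num) (by norm_num) (by norm_num) (ν := (23/40 : ℝ))
    (by push_cast; exact ⟨le_rfl, le_rfl⟩)).2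
  push_cast at hF hT
  exact dWeightNode_fermiEnergyOf_mem_Icc_of_mem_box_num (El := ((2617 : ℝ) / 2000)) (Eh := ((27021 : ℝ) / 10000)) (by norm_num) (by norm_num) (by norm_num) (by norm_num) hΔ ha hb hc (by norm_num)
    (by norm_num) (by norm_num) hF.1 hT.2 (by norm_num [dWeightNodeCF]) (by norm_num [dWeightNodeCF])

end Summit.Ventures.CertifiedManyBodySolver.Downfold.Emery
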